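import Literature.NumberTheory.Rogawski1990.ArchSchwartzOrbitalIntegralConvergence   -- ★ p848470: (CONV) modulo `hvol`
import Literature.NumberTheory.Rogawski1990.TransferFactsCanonical                  -- ★ `OrbitalMeasureFamily.IsQuotientOf` ((W_H))
import Literature.NumberTheory.Automorphic.UnitaryGroupArchimedeanPlaces            -- ★ `archLocal`, `archPiEquivCM`
import Literature.NumberTheory.Rogawski1990.ArchQuotientHSBallVolumeProduct             -- ★ p849029 (LH3-p01, DEAL #17): `measure_setOf_descConj_archHSGL_endoEmbArch_le_of_isQuotientOf` = (D3) — ED. 2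
import HarnessLib

/-!
# (CONV) at EVERY `G`-regular class of `H_∞`, BY HYPOTHESES: one per-place quotient-growth token for elliptic and split places alike
# (the junction head of line LH3's (CONV)∕(VOL) chain; Beuzart-Plessis 2020 §1.5)

Topic `NumberTheory/Rogawski1990`; namespace `Literature.NumberTheory.Rogawski1990`.  THEOREMS ONLY (no `def`, no instance, no notation, no axiom, no named fact,
no `sorry`).  Cell `pub/hodgecm-mathlib`, crux H413 (`stmt-HodgeConjecture-24833`), F0∕P3c line LH3, DEAL #18 (CONV-total by hypotheses) of LH3-plan (g0) (2026-09-02T03:43:31Z;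
seat LH3-p04 (g0)).

THE HEAD `integrable_orbitalIntegrand_of_archSchwartzGL_of_placewise_growth`: for the Weil-form family `mH` ((W_H) = ★ `IsQuotientOf (IsArchGRegular L) νH tH`), a `G`-regular class
`c`, and a Schwartz `g` (★ `ArchSchwartzGL L 3 𝔩 (1∕2) ι_∞ g`), the orbital integrand ★ `descConj c.out Z(c.out) _ g` is `mH c`-integrable, GIVEN two named inputs:
* `hD3` — «places multiply on the quotient» (LH3-p01 (g2)'s DEAL #17 (D3), to be imported once ★): for invariant, finite-on-compacts, σ-finite, non-zero measures `μ_w` on the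
  per-place quotients `U(Φ₂)(ℂ)_w ⧸ Z(γ_w)` (`γ_w = archPiEquivCM … c.out.1 w`), per-place growth `μ_w{HS_w + 1 ≤ ρ} ≤ C ρ^{1∕2}` implies the volume hypothesis `hvol` of
  ★ `integrable_orbitalIntegrand_of_archSchwartzGL_of_volumeGrowth` (p848470) for `mH c` (★ `archHSGL_endoEmbArch`: `archHSGL ∘ ι_∞ = ∏_w (HS_w + 1)`);
* `hplace` — THE ONE PER-PLACE TOKEN: `μ_w {x̄ | Σ_ij |(x̄ γ_w x̄⁻¹)_ij|² + 1 ≤ ρ} ≤ C ρ^{1∕2}` (`ρ ≥ 1`) — discharged at an ELLIPTIC place by LH3-p03's ★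
  `haar_setOf_hs_conj_le_of_elliptic_linear` + the compact descent ★ `quotientMeasure_setOf_le_of_compact_of_group_bound` (p848739 §1, `G := U(Φ₂)(ℂ)_w`), and at a SPLIT place
  by LH2-p04 (g2)'s `quotientMeasure_hsOrbitBall_le_sqrt_of_split` (HEAD (ii) of DEAL #11).
HONEST LABEL: HC_CM is proved only modulo the 7 printed citations (2 remaining: hLiu418 = stmt-HodgeConjecture-24832, h413 = stmt-HodgeConjecture-24833) until rung 0
closes; this file closes no organ — it is the junction certifying that the Schwartz orbital integrals of the LETTERS O1∕O3 of `stub_N9` are honest Bochner integrals at every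
`G`-regular class, modulo the two named inputs.

## References
* [BeuzartPlessis2020Asterisque] R. Beuzart-Plessis, *A local trace formula for the Gan–Gross–Prasad conjecture for unitary groups: the archimedean case*,
  Astérisque 418 (2020), §1.5 (1.5.2)–(1.5.3) p. 31.
* [Rogawski1990] J. D. Rogawski, *Automorphic Representations of Unitary Groups in Three Variables*, Ann. of Math. Stud. 123 (1990), §4.3 (4.3.1) p. 43; §1.7 p. 6.
-/

set_option autoImplicit false

noncomputable section

open MeasureTheory Set NumberField NumberField.mixedEmbedding
open Literature.MeasureTheory.Group Literature.NumberTheory.Automorphic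
open scoped ENNReal MatrixGroups Matrix

namespace Literature.NumberTheory.Rogawski1990

section Total

variable {L : Type} [Field L] [NumberField L] [IsCMField L]
    [MeasurableSpace ((↥(UnitaryGroup.arch (↥(maximalRealSubfield L)) L (IsCMField.complexConj L) 2
          (Matrix.of fun i j : Fin 2 => if i.val + j.val + 1 = 2 then (1 : L) else 0)) ×
        ↥(UnitaryGroup.arch (↥(maximalRealSubfield L)) L (IsCMField.complexConj L) 1
          (Matrix.of fun i j : Fin 1 => if i.val + j.val + 1 = 1 then (1 : L) else 0))))]
    [BorelSpace ((↥(UnitaryGroup.arch (↥(maximalRealSubfield L)) L (IsCMField.complexConj L) 2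
          (Matrix.of fun i j : Fin 2 => if i.val + j.val + 1 = 2 then (1 : L) else 0)) ×
        ↥(UnitaryGroup.arch (↥(maximalRealSubfield L)) L (IsCMField.complexConj L) 1
          (Matrix.of fun i j : Fin 1 => if i.val + j.val + 1 = 1 then (1 : L) else 0))))]

/-- **(CONV) AT EVERY `G`-REGULAR CLASS, BY HYPOTHESES** — the junction head: ★ `integrable_orbitalIntegrand_of_archSchwartzGL_of_volumeGrowth` (p848470) fed by the
«places multiply on the quotient» input `hD3` (LH3-p01's DEAL #17 (D3)) and the unified per-place growth token `hplace` (elliptic places: LH3-p03 ★ + compact descent;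
split places: LH2-p04's HEAD (ii)). [cite: BeuzartPlessis2020Asterisque, §1.5 (1.5.2)–(1.5.3) p. 31] [cite: Rogawski1990, §4.3 (4.3.1) p. 43; §1.7 p. 6] -/
theorem integrable_orbitalIntegrand_of_archSchwartzGL_of_placewise_growth
    (νH : Measure ((↥(UnitaryGroup.arch (↥(maximalRealSubfield L)) L (IsCMField.complexConj L) 2
          (Matrix.of fun i j : Fin 2 => if i.val + j.val + 1 = 2 then (1 : L) else 0)) ×
        ↥(UnitaryGroup.arch (↥(maximalRealSubfield L)) L (IsCMField.complexConj L) 1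
          (Matrix.of fun i j : Fin 1 => if i.val + j.val + 1 = 1 then (1 : L) else 0)))))
    [νH.IsHaarMeasure] [νH.IsMulRightInvariant]
    [∀ a : ((↥(UnitaryGroup.arch (↥(maximalRealSubfield L)) L (IsCMField.complexConj L) 2
          (Matrix.of fun i j : Fin 2 => if i.val + j.val + 1 = 2 then (1 : L) else 0)) ×
        ↥(UnitaryGroup.arch (↥(maximalRealSubfield L)) L (IsCMField.complexConj L) 1
          (Matrix.of fun i j : Fin 1 => if i.val + j.val + 1 = 1 then (1 : L) else 0)))),
      MeasurableSpace (((↥(UnitaryGroup.arch (↥(maximalRealSubfield L)) L (IsCMField.complexConj L) 2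
          (Matrix.of fun i j : Fin 2 => if i.val + j.val + 1 = 2 then (1 : L) else 0)) ×
        ↥(UnitaryGroup.arch (↥(maximalRealSubfield L)) L (IsCMField.complexConj L) 1
          (Matrix.of fun i j : Fin 1 => if i.val + j.val + 1 = 1 then (1 : L) else 0)))) ⧸ Subgroup.centralizer ({a} : Set _))]
    [∀ a : ((↥(UnitaryGroup.arch (↥(maximalRealSubfield L)) L (IsCMField.complexConj L) 2
          (Matrix.of fun i j : Fin 2 => if i.val + j.val + 1 = 2 then (1 : L) else 0)) ×
        ↥(UnitaryGroup.arch (↥(maximalRealSubfield L)) L (IsCMField.complexConj L) 1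
          (Matrix.of fun i j : Fin 1 => if i.val + j.val + 1 = 1 then (1 : L) else 0)))),
      BorelSpace (((↥(UnitaryGroup.arch (↥(maximalRealSubfield L)) L (IsCMField.complexConj L) 2
          (Matrix.of fun i j : Fin 2 => if i.val + j.val + 1 = 2 then (1 : L) else 0)) ×
        ↥(UnitaryGroup.arch (↥(maximalRealSubfield L)) L (IsCMField.complexConj L) 1
          (Matrix.of fun i j : Fin 1 => if i.val + j.val + 1 = 1 then (1 : L) else 0)))) ⧸ Subgroup.centralizer ({a} : Set _))]
    (tH : ∀ γH : ((↥(UnitaryGroup.arch (↥(maximalRealSubfield L)) L (IsCMField.complexConj L) 2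
          (Matrix.of fun i j : Fin 2 => if i.val + j.val + 1 = 2 then (1 : L) else 0)) ×
        ↥(UnitaryGroup.arch (↥(maximalRealSubfield L)) L (IsCMField.complexConj L) 1
          (Matrix.of fun i j : Fin 1 => if i.val + j.val + 1 = 1 then (1 : L) else 0)))),
      Measure ↥(Subgroup.centralizer ({γH} : Set _)))
    (mH : OrbitalMeasureFamily ((↥(UnitaryGroup.arch (↥(maximalRealSubfield L)) L (IsCMField.complexConj L) 2
          (Matrix.of fun i j : Fin 2 => if i.val + j.val + 1 = 2 then (1 : L) else 0)) ×
        ↥(UnitaryGroup.arch (↥(maximalRealSubfield L)) L (IsCMField.complexConj L) 1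
          (Matrix.of fun i j : Fin 1 => if i.val + j.val + 1 = 1 then (1 : L) else 0)))))
    (hW : mH.IsQuotientOf (IsArchGRegular L) νH tH)
    (𝔩 : Set (Matrix (Fin 3) (Fin 3) (mixedSpace L)))
    {g : ((↥(UnitaryGroup.arch (↥(maximalRealSubfield L)) L (IsCMField.complexConj L) 2
          (Matrix.of fun i j : Fin 2 => if i.val + j.val + 1 = 2 then (1 : L) else 0)) ×
        ↥(UnitaryGroup.arch (↥(maximalRealSubfield L)) L (IsCMField.complexConj L) 1
          (Matrix.of fun i j : Fin 1 => if i.val + j.val + 1 = 1 then (1 : L) else 0)))) → ℂ}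
    (hg : ArchSchwartzGL L 3 𝔩 (1 / (2 : ℝ)) (fun k => ((endoEmbArch L k).val : GL (Fin 3) (mixedSpace L))) g)
    (c : ConjClasses ((↥(UnitaryGroup.arch (↥(maximalRealSubfield L)) L (IsCMField.complexConj L) 2
          (Matrix.of fun i j : Fin 2 => if i.val + j.val + 1 = 2 then (1 : L) else 0)) ×
        ↥(UnitaryGroup.arch (↥(maximalRealSubfield L)) L (IsCMField.complexConj L) 1
          (Matrix.of fun i j : Fin 1 => if i.val + j.val + 1 = 1 then (1 : L) else 0)))))
    (hc : IsArchGRegular L (Quotient.out c))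
    [∀ w : {w : InfinitePlace L // w.IsComplex}, MeasurableSpace (↥(UnitaryGroup.archLocal L 2 (Matrix.of fun i j : Fin 2 => if i.val + j.val + 1 = 2 then (1 : L) else 0) w) ⧸ Subgroup.centralizer ({(UnitaryGroup.archPiEquivCM 2 L (Matrix.of fun i j : Fin 2 => if i.val + j.val + 1 = 2 then (1 : L) else 0) (Quotient.out c).1 w)} : Set ↥(UnitaryGroup.archLocal L 2 (Matrix.of fun i j : Fin 2 => if i.val + j.val + 1 = 2 then (1 : L) else 0) w)))]
    [∀ w : {w : InfinitePlace L // w.IsComplex}, BorelSpace (↥(UnitaryGroup.archLocal L 2 (Matrix.of fun i j : Fin 2 => if i.val + j.val + 1 = 2 then (1 : L) else 0) w) ⧸ Subgroup.centralizer ({(UnitaryGroup.archPiEquivCM 2 L (Matrix.of fun i j : Fin 2 => if i.val + j.val + 1 = 2 then (1 : L) else 0) (Quotient.out c).1 w)} : Set ↥(UnitaryGroup.archLocal L 2 (Matrix.of fun i j : Fin 2 => if i.val + j.val + 1 = 2 then (1 : L) else 0) w)))]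
    (hD3 : mH.IsQuotientOf (IsArchGRegular L) νH tH → IsArchGRegular L (Quotient.out c) →
      ∀ (μw : ∀ w : {w : InfinitePlace L // w.IsComplex}, Measure (↥(UnitaryGroup.archLocal L 2 (Matrix.of fun i j : Fin 2 => if i.val + j.val + 1 = 2 then (1 : L) else 0) w) ⧸ Subgroup.centralizer ({(UnitaryGroup.archPiEquivCM 2 L (Matrix.of fun i j : Fin 2 => if i.val + j.val + 1 = 2 then (1 : L) else 0) (Quotient.out c).1 w)} : Set ↥(UnitaryGroup.archLocal L 2 (Matrix.of fun i j : Fin 2 => if i.val + j.val + 1 = 2 then (1 : L) else 0) w))))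
        [∀ w, SMulInvariantMeasure ↥(UnitaryGroup.archLocal L 2 (Matrix.of fun i j : Fin 2 => if i.val + j.val + 1 = 2 then (1 : L) else 0) w) (↥(UnitaryGroup.archLocal L 2 (Matrix.of fun i j : Fin 2 => if i.val + j.val + 1 = 2 then (1 : L) else 0) w) ⧸ Subgroup.centralizer ({(UnitaryGroup.archPiEquivCM 2 L (Matrix.of fun i j : Fin 2 => if i.val + j.val + 1 = 2 then (1 : L) else 0) (Quotient.out c).1 w)} : Set ↥(UnitaryGroup.archLocal L 2 (Matrix.of fun i j : Fin 2 => if i.val + j.val + 1 = 2 then (1 : L) else 0) w))) (μw w)] [∀ w, IsFiniteMeasureOnCompacts (μw w)] [∀ w, SigmaFinite (μw w)],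
        (∀ w, μw w ≠ 0) →
        (∀ w, ∃ C : ℝ, ∀ ρ : ℝ, 1 ≤ ρ →
          μw w {x | descConj (UnitaryGroup.archPiEquivCM 2 L (Matrix.of fun i j : Fin 2 => if i.val + j.val + 1 = 2 then (1 : L) else 0) (Quotient.out c).1 w) (Subgroup.centralizer ({(UnitaryGroup.archPiEquivCM 2 L (Matrix.of fun i j : Fin 2 => if i.val + j.val + 1 = 2 then (1 : L) else 0) (Quotient.out c).1 w)} : Set ↥(UnitaryGroup.archLocal L 2 (Matrix.of fun i j : Fin 2 => if i.val + j.val + 1 = 2 then (1 : L) else 0) w)))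
            (fun _ h => Subgroup.mem_centralizer_singleton_iff.1 h)
            (fun y : ↥(UnitaryGroup.archLocal L 2 (Matrix.of fun i j : Fin 2 => if i.val + j.val + 1 = 2 then (1 : L) else 0) w) => ∑ i : Fin 2, ∑ j : Fin 2, ‖((y : GL (Fin 2) ℂ) : Matrix (Fin 2) (Fin 2) ℂ) i j‖ ^ 2 + 1) x ≤ ρ} ≤ ENNReal.ofReal (C * ρ ^ (1 / (2 : ℝ)))) →
        ∃ (A : ℝ) (m : ℕ), ∀ R : ℝ, 1 ≤ R →
          (mH c) {x | descConj (Quotient.out c) (Subgroup.centralizer ({Quotient.out c} : Set _))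
              (fun _ h => Subgroup.mem_centralizer_singleton_iff.1 h)
              (fun y => archHSGL L 3 ((endoEmbArch L y).val : GL (Fin 3) (mixedSpace L))) x ≤ R} ≤
            ENNReal.ofReal (A * R ^ (1 / (2 : ℝ)) * (1 + Real.log R) ^ m))
    (μw : ∀ w : {w : InfinitePlace L // w.IsComplex}, Measure (↥(UnitaryGroup.archLocal L 2 (Matrix.of fun i j : Fin 2 => if i.val + j.val + 1 = 2 then (1 : L) else 0) w) ⧸ Subgroup.centralizer ({(UnitaryGroup.archPiEquivCM 2 L (Matrix.of fun i j : Fin 2 => if i.val + j.val + 1 = 2 then (1 : L) else 0) (Quotient.out c).1 w)} : Set ↥(UnitaryGroup.archLocal L 2 (Matrix.of fun i j : Fin 2 => if i.val + j.val + 1 = 2 then (1 : L) else 0) w))))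
    [∀ w, SMulInvariantMeasure ↥(UnitaryGroup.archLocal L 2 (Matrix.of fun i j : Fin 2 => if i.val + j.val + 1 = 2 then (1 : L) else 0) w) (↥(UnitaryGroup.archLocal L 2 (Matrix.of fun i j : Fin 2 => if i.val + j.val + 1 = 2 then (1 : L) else 0) w) ⧸ Subgroup.centralizer ({(UnitaryGroup.archPiEquivCM 2 L (Matrix.of fun i j : Fin 2 => if i.val + j.val + 1 = 2 then (1 : L) else 0) (Quotient.out c).1 w)} : Set ↥(UnitaryGroup.archLocal L 2 (Matrix.of fun i j : Fin 2 => if i.val + j.val + 1 = 2 then (1 : L) else 0) w))) (μw w)] [∀ w, IsFiniteMeasureOnCompacts (μw w)] [∀ w, SigmaFinite (μw w)]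
    (hμw : ∀ w, μw w ≠ 0)
    (hplace : ∀ w, ∃ C : ℝ, ∀ ρ : ℝ, 1 ≤ ρ →
          μw w {x | descConj (UnitaryGroup.archPiEquivCM 2 L (Matrix.of fun i j : Fin 2 => if i.val + j.val + 1 = 2 then (1 : L) else 0) (Quotient.out c).1 w) (Subgroup.centralizer ({(UnitaryGroup.archPiEquivCM 2 L (Matrix.of fun i j : Fin 2 => if i.val + j.val + 1 = 2 then (1 : L) else 0) (Quotient.out c).1 w)} : Set ↥(UnitaryGroup.archLocal L 2 (Matrix.of fun i j : Fin 2 => if i.val + j.val + 1 = 2 then (1 : L) else 0) w)))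
            (fun _ h => Subgroup.mem_centralizer_singleton_iff.1 h)
            (fun y : ↥(UnitaryGroup.archLocal L 2 (Matrix.of fun i j : Fin 2 => if i.val + j.val + 1 = 2 then (1 : L) else 0) w) => ∑ i : Fin 2, ∑ j : Fin 2, ‖((y : GL (Fin 2) ℂ) : Matrix (Fin 2) (Fin 2) ℂ) i j‖ ^ 2 + 1) x ≤ ρ} ≤ ENNReal.ofReal (C * ρ ^ (1 / (2 : ℝ)))) :
    Integrable (descConj (Quotient.out c) (Subgroup.centralizer ({Quotient.out c} : Set _))
      (fun _ h => Subgroup.mem_centralizer_singleton_iff.1 h) g) (mH c) :=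
  integrable_orbitalIntegrand_of_archSchwartzGL_of_volumeGrowth 𝔩 (by norm_num) hg mH c (hD3 hW hc μw hμw hplace)

/-- **(CONV) AT EVERY `G`-REGULAR CLASS FROM THE PER-PLACE TOKEN ALONE (ED. 2)** — as above with the «places multiply on the quotient» input DISCHARGED by LH3-p01's ★
`measure_setOf_descConj_archHSGL_endoEmbArch_le_of_isQuotientOf` (p849029): the only remaining input is the unified per-place growth token `hplace` (elliptic places:
LH3-p03 ★ + ★ compact descent; split places: LH2-p04's HEAD (ii)). [cite: BeuzartPlessis2020Asterisque, §1.5 (1.5.2)–(1.5.3) p. 31] [cite: Rogawski1990, §4.3 (4.3.1) p. 43; §1.7 p. 6] -/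
theorem integrable_orbitalIntegrand_of_archSchwartzGL_of_placewise_growth'
    (νH : Measure ((↥(UnitaryGroup.arch (↥(maximalRealSubfield L)) L (IsCMField.complexConj L) 2
          (Matrix.of fun i j : Fin 2 => if i.val + j.val + 1 = 2 then (1 : L) else 0)) ×
        ↥(UnitaryGroup.arch (↥(maximalRealSubfield L)) L (IsCMField.complexConj L) 1
          (Matrix.of fun i j : Fin 1 => if i.val + j.val + 1 = 1 then (1 : L) else 0)))))
    [νH.IsHaarMeasure] [νH.IsMulRightInvariant]
    [∀ a : ((↥(UnitaryGroup.arch (↥(maximalRealSubfield L)) L (IsCMField.complexConj L) 2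
          (Matrix.of fun i j : Fin 2 => if i.val + j.val + 1 = 2 then (1 : L) else 0)) ×
        ↥(UnitaryGroup.arch (↥(maximalRealSubfield L)) L (IsCMField.complexConj L) 1
          (Matrix.of fun i j : Fin 1 => if i.val + j.val + 1 = 1 then (1 : L) else 0)))),
      MeasurableSpace (((↥(UnitaryGroup.arch (↥(maximalRealSubfield L)) L (IsCMField.complexConj L) 2
          (Matrix.of fun i j : Fin 2 => if i.val + j.val + 1 = 2 then (1 : L) else 0)) ×
        ↥(UnitaryGroup.arch (↥(maximalRealSubfield L)) L (IsCMField.complexConj L) 1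
          (Matrix.of fun i j : Fin 1 => if i.val + j.val + 1 = 1 then (1 : L) else 0)))) ⧸ Subgroup.centralizer ({a} : Set _))]
    [∀ a : ((↥(UnitaryGroup.arch (↥(maximalRealSubfield L)) L (IsCMField.complexConj L) 2
          (Matrix.of fun i j : Fin 2 => if i.val + j.val + 1 = 2 then (1 : L) else 0)) ×
        ↥(UnitaryGroup.arch (↥(maximalRealSubfield L)) L (IsCMField.complexConj L) 1
          (Matrix.of fun i j : Fin 1 => if i.val + j.val + 1 = 1 then (1 : L) else 0)))),
      BorelSpace (((↥(UnitaryGroup.arch (↥(maximalRealSubfield L)) L (IsCMField.complexConj L) 2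
          (Matrix.of fun i j : Fin 2 => if i.val + j.val + 1 = 2 then (1 : L) else 0)) ×
        ↥(UnitaryGroup.arch (↥(maximalRealSubfield L)) L (IsCMField.complexConj L) 1
          (Matrix.of fun i j : Fin 1 => if i.val + j.val + 1 = 1 then (1 : L) else 0)))) ⧸ Subgroup.centralizer ({a} : Set _))]
    (tH : ∀ γH : ((↥(UnitaryGroup.arch (↥(maximalRealSubfield L)) L (IsCMField.complexConj L) 2
          (Matrix.of fun i j : Fin 2 => if i.val + j.val + 1 = 2 then (1 : L) else 0)) ×
        ↥(UnitaryGroup.arch (↥(maximalRealSubfield L)) L (IsCMField.complexConj L) 1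
          (Matrix.of fun i j : Fin 1 => if i.val + j.val + 1 = 1 then (1 : L) else 0)))),
      Measure ↥(Subgroup.centralizer ({γH} : Set _)))
    (mH : OrbitalMeasureFamily ((↥(UnitaryGroup.arch (↥(maximalRealSubfield L)) L (IsCMField.complexConj L) 2
          (Matrix.of fun i j : Fin 2 => if i.val + j.val + 1 = 2 then (1 : L) else 0)) ×
        ↥(UnitaryGroup.arch (↥(maximalRealSubfield L)) L (IsCMField.complexConj L) 1
          (Matrix.of fun i j : Fin 1 => if i.val + j.val + 1 = 1 then (1 : L) else 0)))))
    (hW : mH.IsQuotientOf (IsArchGRegular L) νH tH)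
    (𝔩 : Set (Matrix (Fin 3) (Fin 3) (mixedSpace L)))
    {g : ((↥(UnitaryGroup.arch (↥(maximalRealSubfield L)) L (IsCMField.complexConj L) 2
          (Matrix.of fun i j : Fin 2 => if i.val + j.val + 1 = 2 then (1 : L) else 0)) ×
        ↥(UnitaryGroup.arch (↥(maximalRealSubfield L)) L (IsCMField.complexConj L) 1
          (Matrix.of fun i j : Fin 1 => if i.val + j.val + 1 = 1 then (1 : L) else 0)))) → ℂ}
    (hg : ArchSchwartzGL L 3 𝔩 (1 / (2 : ℝ)) (fun k => ((endoEmbArch L k).val : GL (Fin 3) (mixedSpace L))) g)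
    (c : ConjClasses ((↥(UnitaryGroup.arch (↥(maximalRealSubfield L)) L (IsCMField.complexConj L) 2
          (Matrix.of fun i j : Fin 2 => if i.val + j.val + 1 = 2 then (1 : L) else 0)) ×
        ↥(UnitaryGroup.arch (↥(maximalRealSubfield L)) L (IsCMField.complexConj L) 1
          (Matrix.of fun i j : Fin 1 => if i.val + j.val + 1 = 1 then (1 : L) else 0)))))
    (hc : IsArchGRegular L (Quotient.out c))
    [∀ w : {w : InfinitePlace L // w.IsComplex}, MeasurableSpace (↥(UnitaryGroup.archLocal L 2 (Matrix.of fun i j : Fin 2 => if i.val + j.val + 1 = 2 then (1 : L) else 0) w) ⧸ Subgroup.centralizer ({(UnitaryGroup.archPiEquivCM 2 L (Matrix.of fun i j : Fin 2 => if i.val + j.val + 1 = 2 then (1 : L) else 0) (Quotient.out c).1 w)} : Set ↥(UnitaryGroup.archLocal L 2 (Matrix.of fun i j : Fin 2 => if i.val + j.val + 1 = 2 then (1 : L) else 0) w)))]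
    [∀ w : {w : InfinitePlace L // w.IsComplex}, BorelSpace (↥(UnitaryGroup.archLocal L 2 (Matrix.of fun i j : Fin 2 => if i.val + j.val + 1 = 2 then (1 : L) else 0) w) ⧸ Subgroup.centralizer ({(UnitaryGroup.archPiEquivCM 2 L (Matrix.of fun i j : Fin 2 => if i.val + j.val + 1 = 2 then (1 : L) else 0) (Quotient.out c).1 w)} : Set ↥(UnitaryGroup.archLocal L 2 (Matrix.of fun i j : Fin 2 => if i.val + j.val + 1 = 2 then (1 : L) else 0) w)))]
    (μw : ∀ w : {w : InfinitePlace L // w.IsComplex}, Measure (↥(UnitaryGroup.archLocal L 2 (Matrix.of fun i j : Fin 2 => if i.val + j.val + 1 = 2 then (1 : L) else 0) w) ⧸ Subgroup.centralizer ({(UnitaryGroup.archPiEquivCM 2 L (Matrix.of fun i j : Fin 2 => if i.val + j.val + 1 = 2 then (1 : L) else 0) (Quotient.out c).1 w)} : Set ↥(UnitaryGroup.archLocal L 2 (Matrix.of fun i j : Fin 2 => if i.val + j.val + 1 = 2 then (1 : L) else 0) w))))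
    [∀ w, SMulInvariantMeasure ↥(UnitaryGroup.archLocal L 2 (Matrix.of fun i j : Fin 2 => if i.val + j.val + 1 = 2 then (1 : L) else 0) w) (↥(UnitaryGroup.archLocal L 2 (Matrix.of fun i j : Fin 2 => if i.val + j.val + 1 = 2 then (1 : L) else 0) w) ⧸ Subgroup.centralizer ({(UnitaryGroup.archPiEquivCM 2 L (Matrix.of fun i j : Fin 2 => if i.val + j.val + 1 = 2 then (1 : L) else 0) (Quotient.out c).1 w)} : Set ↥(UnitaryGroup.archLocal L 2 (Matrix.of fun i j : Fin 2 => if i.val + j.val + 1 = 2 then (1 : L) else 0) w))) (μw w)] [∀ w, IsFiniteMeasureOnCompacts (μw w)] [∀ w, SigmaFinite (μw w)]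
    (hμw : ∀ w, μw w ≠ 0)
    (hplace : ∀ w, ∃ C : ℝ, ∀ ρ : ℝ, 1 ≤ ρ →
          μw w {x | descConj (UnitaryGroup.archPiEquivCM 2 L (Matrix.of fun i j : Fin 2 => if i.val + j.val + 1 = 2 then (1 : L) else 0) (Quotient.out c).1 w) (Subgroup.centralizer ({(UnitaryGroup.archPiEquivCM 2 L (Matrix.of fun i j : Fin 2 => if i.val + j.val + 1 = 2 then (1 : L) else 0) (Quotient.out c).1 w)} : Set ↥(UnitaryGroup.archLocal L 2 (Matrix.of fun i j : Fin 2 => if i.val + j.val + 1 = 2 then (1 : L) else 0) w)))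
            (fun _ h => Subgroup.mem_centralizer_singleton_iff.1 h)
            (fun y : ↥(UnitaryGroup.archLocal L 2 (Matrix.of fun i j : Fin 2 => if i.val + j.val + 1 = 2 then (1 : L) else 0) w) => ∑ i : Fin 2, ∑ j : Fin 2, ‖((y : GL (Fin 2) ℂ) : Matrix (Fin 2) (Fin 2) ℂ) i j‖ ^ 2 + 1) x ≤ ρ} ≤ ENNReal.ofReal (C * ρ ^ (1 / (2 : ℝ)))) :
    Integrable (descConj (Quotient.out c) (Subgroup.centralizer ({Quotient.out c} : Set _))
      (fun _ h => Subgroup.mem_centralizer_singleton_iff.1 h) g) (mH c) :=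
  integrable_orbitalIntegrand_of_archSchwartzGL_of_volumeGrowth 𝔩 (by norm_num) hg mH c (measure_setOf_descConj_archHSGL_endoEmbArch_le_of_isQuotientOf L νH tH mH hW c hc μw hμw (by norm_num) hplace)

end Total

end Literature.NumberTheory.Rogawski1990

end
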